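import Literature.Topology.PlaneTopology.LocallyConnectedContinua
import Literature.Topology.PlaneTopology.BandCrossing
import HarnessLib

/-!
# Connectedness im kleinen: boundary bumping, upper limits of continua, and Moore's theorem

Topic: Topology / PlaneTopology (general metric spaces). A set `K` is **connected im kleinen at
`x`** (`IsCIKAt K x`) if every ball about `x` contains a smaller ball all of whose points of `K`
lie in the component of `x` of `K` inside the bigger ball (Whyburn, *Analytic Topology* (1942),
Ch. I §12; Kuratowski, *Topology* II (1968), §49). We prove the classical facts needed to show
that a continuum which is "nice away from one point" is nice everywhere:

* `exists_mem_connectedComponentIn_level`, `exists_mem_connectedComponentIn_sphere` — **boundary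
  bumping**: in a continuum `K`, the component of `x` in `K ∩ {ρ ≤ φ}` reaches the level
  `{φ = ρ}` as soon as `K` meets `{φ < ρ}` (cut-wire theorem
  `Literature.Topology.PlaneTopology.exists_isClopen_superset_disjoint`); in particular the
  component of `x` in `K ∩ B̄(p, r)` reaches the sphere `{dist · p = r}`;
* `seqLimsup` — the topological upper limit `Ls Dₙ` of a sequence of sets, closed
  (`isClosed_seqLimsup`), and **connected when the `Dₙ` are connected and `Li Dₙ ≠ ∅`**
  (`isPreconnected_seqLimsup`; Kuratowski II §47.II Thm. 6);
* `IsCIKAt.of_forall_ne` — **Moore's theorem** (Kuratowski II §49.VI; Whyburn I (12.3)): a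
  continuum which is connected im kleinen at every point other than `p` is connected im kleinen
  at `p` as well (if not, nearby points `yₙ → p` have components `Dₙ` in `K ∩ B̄(p, e)` avoiding
  that of `p`; they reach the sphere of radius `e`, so `L = Ls Dₙ` is a continuum through `p`
  out to that sphere, inside the component of `p`; at a point `q ∈ L` half-way, connectedness im
  kleinen produces a connected neighbourhood meeting some `Dₙ`, forcing `Dₙ` to be the component
  of `p` — contradiction);
* `isUniformlyLocallyConnected_of_forall_isCIKAt` — a compact set connected im kleinen at each of
  its points is uniformly locally connected in Pommerenke's sense
  (`Literature.Topology.PlaneTopology.IsUniformlyLocallyConnected`, the hypothesis of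
  Carathéodory's continuity theorem), by a finite subcover.

Mathlib has `LocallyConnectedSpace` and `connectedComponentIn` but neither connectedness im
kleinen of a subset at a point, nor boundary bumping, nor `Ls`/`Li` of sequences of sets
(searched `im kleinen`, `boundary bumping`, `Kuratowski limit`, `limsup` of sets in `Topology`).

## References

* K. Kuratowski, *Topology*, Vol. II, Academic Press (1968), §47.II–III (limits of connected
  sets, boundary bumping), §49.VI (points of non-local-connectedness form continua).
* G. T. Whyburn, *Analytic Topology*, AMS Colloq. Publ. 28 (1942), Ch. I §12, (12.1)–(12.3).
* Ch. Pommerenke, *Boundary Behaviour of Conformal Maps*, Springer (1992), §2.2.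
-/

noncomputable section

open Set Filter Topology Metric

namespace Literature.Topology.PlaneTopology

variable {X : Type*} [MetricSpace X]

/-! ### Connectedness im kleinen at a point -/

/-- `K` is **connected im kleinen at `x`**: for every `ε > 0` there is `δ > 0` such that every
point of `K ∩ B(x, δ)` lies in the connected component of `x` in `K ∩ B(x, ε)`.
Whyburn (1942), Ch. I §12; Kuratowski II §49. [cite: PommerenkeBBCM1992, §2.2] -/
def IsCIKAt (K : Set X) (x : X) : Prop :=
  ∀ ε > 0, ∃ δ > 0, K ∩ ball x δ ⊆ connectedComponentIn (K ∩ ball x ε) x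

namespace IsCIKAt

variable {K : Set X} {x : X}

/-- The form with connected joining sets: every point of `K` near `x` is joined to `x` by a
preconnected subset of `K` inside the small ball. [folklore] -/
theorem iff_exists : IsCIKAt K x ↔ ∀ ε > 0, ∃ δ > 0, ∀ y ∈ K, dist y x < δ →
    ∃ S ⊆ K ∩ ball x ε, IsPreconnected S ∧ x ∈ S ∧ y ∈ S := by
  constructor
  · intro h ε hε
    obtain ⟨δ, hδ, hsub⟩ := h ε hε
    refine ⟨δ, hδ, fun y hy hyx ↦ ?_⟩
    have hyC : y ∈ connectedComponentIn (K ∩ ball x ε) x := hsub ⟨hy, mem_ball.2 hyx⟩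
    have hxC : x ∈ connectedComponentIn (K ∩ ball x ε) x := by
      have hne : (connectedComponentIn (K ∩ ball x ε) x).Nonempty := ⟨y, hyC⟩
      by_contra hx
      have hxF : x ∉ K ∩ ball x ε := fun hxF ↦ hx (mem_connectedComponentIn hxF)
      rw [connectedComponentIn_eq_empty hxF] at hne
      exact hne.ne_empty rfl
    exact ⟨_, connectedComponentIn_subset _ _, isPreconnected_connectedComponentIn, hxC, hyC⟩
  · intro h ε hε
    obtain ⟨δ, hδ, hS⟩ := h ε hε
    refine ⟨δ, hδ, fun y hy ↦ ?_⟩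
    obtain ⟨S, hSsub, hSc, hxS, hyS⟩ := hS y hy.1 (mem_ball.1 hy.2)
    exact hSc.subset_connectedComponentIn hxS hSsub hyS

/-- A set is connected im kleinen at every point about which it contains a preconnected ball
(e.g. any ball of a normed space). [folklore] -/
theorem of_ball_subset {r : ℝ} (hr : 0 < r) (hK : ball x r ⊆ K)
    (hballs : ∀ ρ, 0 < ρ → ρ ≤ r → IsPreconnected (ball x ρ)) : IsCIKAt K x := by
  intro ε hε
  refine ⟨min r ε, lt_min hr hε, fun y hy ↦ ?_⟩
  have hsub : ball x (min r ε) ⊆ K ∩ ball x ε := fun z hz ↦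
    ⟨hK (ball_subset_ball (min_le_left _ _) hz), ball_subset_ball (min_le_right _ _) hz⟩
  exact (hballs _ (lt_min hr hε) (min_le_left _ _)).subset_connectedComponentIn
    (mem_ball_self (lt_min hr hε)) hsub hy.2

/-- Shrinking the target radius is harmless: the defining inclusion for `ε` gives it for every
`ε' ≥ ε`. [folklore] -/
theorem mono_radius {ε ε' δ : ℝ} (hεε' : ε ≤ ε')
    (h : K ∩ ball x δ ⊆ connectedComponentIn (K ∩ ball x ε) x) :
    K ∩ ball x δ ⊆ connectedComponentIn (K ∩ ball x ε') x :=
  h.trans (connectedComponentIn_mono x (inter_subset_inter_right _ (ball_subset_ball hεε')))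

end IsCIKAt

/-! ### Boundary bumping -/

/-- **Boundary bumping for a level set.** Let `K` be compact and preconnected, `φ` continuous,
`x ∈ K` with `ρ ≤ φ x`, and suppose `K` meets `{φ < ρ}`. Then the connected component of `x` in
`K ∩ {ρ ≤ φ}` contains a point of the level set `{φ = ρ}` (cut-wire theorem in the compact space
`K ∩ {ρ ≤ φ}`: otherwise a clopen set of it containing `x` inside `{ρ < φ}` would be clopen in `K`).
Kuratowski II §47.III. [cite: PommerenkeBBCM1992, §2.2] -/
theorem exists_mem_connectedComponentIn_level {K : Set X} (hK : IsCompact K) (hKc : IsPreconnected K)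
    {φ : X → ℝ} (hφ : Continuous φ) {ρ : ℝ} {x : X} (hx : x ∈ K) (hxρ : ρ ≤ φ x)
    (hlow : ∃ y ∈ K, φ y < ρ) :
    ∃ z ∈ connectedComponentIn (K ∩ {z | ρ ≤ φ z}) x, φ z = ρ := by
  set Z : Set X := K ∩ {z | ρ ≤ φ z} with hZ
  have hZc : IsCompact Z := hK.inter_right (isClosed_le continuous_const hφ)
  haveI : CompactSpace Z := isCompact_iff_compactSpace.1 hZc
  have hxZ : x ∈ Z := ⟨hx, hxρ⟩
  by_contra hcon
  push Not at hcon
  set x' : Z := ⟨x, hxZ⟩ with hx'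
  set B : Set Z := {z | φ (z : X) = ρ} with hB
  have hBc : IsClosed B := isClosed_eq (hφ.comp continuous_subtype_val) continuous_const
  have hdisj : ∀ y ∈ ({x'} : Set Z), Disjoint (connectedComponent y) B := by
    intro y hy
    rw [mem_singleton_iff.1 hy]
    refine Set.disjoint_left.2 fun z hz hzB ↦ hcon z ?_ hzB
    rw [connectedComponentIn_eq_image hxZ]
    exact ⟨z, hz, rfl⟩
  obtain ⟨U, hU, hxU, hUB⟩ := exists_isClopen_superset_disjoint isClosed_singleton hBc hdisj
  have hxU' : x' ∈ U := hxU (mem_singleton _)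
  obtain ⟨O, hO, hOU⟩ := isOpen_induced_iff.1 hU.isOpen
  obtain ⟨O', hO', hO'U⟩ := isOpen_induced_iff.1 hU.compl.isOpen
  have hUφ : ∀ z ∈ U, ρ < φ (z : X) := fun z hz ↦
    lt_of_le_of_ne z.2.2 fun h ↦ Set.disjoint_left.1 hUB hz h.symm
  set u : Set X := O ∩ {z | ρ < φ z} with hu
  set v : Set X := {z | φ z < ρ} ∪ O' with hv
  have huo : IsOpen u := hO.inter (isOpen_lt continuous_const hφ)
  have hvo : IsOpen v := (isOpen_lt hφ continuous_const).union hO'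
  have hKu : ∀ z ∈ K, z ∈ u → ∃ hz : z ∈ Z, (⟨z, hz⟩ : Z) ∈ U := by
    rintro z hzK ⟨hzO, hzφ⟩
    have hzφ' : ρ < φ z := hzφ
    refine ⟨⟨hzK, hzφ'.le⟩, ?_⟩
    rw [← hOU]
    exact hzO
  have hKv : ∀ z ∈ K, z ∈ v → ∀ hz : z ∈ Z, (⟨z, hz⟩ : Z) ∉ U := by
    rintro z hzK (hzφ | hzO') hz hzU
    · exact absurd (hUφ _ hzU) (not_lt.2 (le_of_lt hzφ))
    · have : (⟨z, hz⟩ : Z) ∈ Uᶜ := by rw [← hO'U]; exact hzO'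
      exact this hzU
  have hcover : K ⊆ u ∪ v := by
    intro z hzK
    by_cases hzφ : φ z < ρ
    · exact Or.inr (Or.inl hzφ)
    · have hz : z ∈ Z := ⟨hzK, not_lt.1 hzφ⟩
      by_cases hzU : (⟨z, hz⟩ : Z) ∈ U
      · refine Or.inl ⟨?_, hUφ _ hzU⟩
        have : (⟨z, hz⟩ : Z) ∈ Subtype.val ⁻¹' O := by rw [hOU]; exact hzU
        exact this
      · refine Or.inr (Or.inr ?_)
        have : (⟨z, hz⟩ : Z) ∈ Subtype.val ⁻¹' O' := by rw [hO'U]; exact hzU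
        exact this
  obtain ⟨y, hyK, hyφ⟩ := hlow
  have hxO : x ∈ O := by
    have : x' ∈ Subtype.val ⁻¹' O := by rw [hOU]; exact hxU'
    exact this
  obtain ⟨z, hzK, hzu, hzv⟩ := hKc u v huo hvo hcover ⟨x, hx, ⟨hxO, hUφ _ hxU'⟩⟩
    ⟨y, hyK, Or.inl hyφ⟩
  obtain ⟨hz, hzU⟩ := hKu z hzK hzu
  exact hKv z hzK hzv hz hzU

/-- **Boundary bumping for balls**: in a compact preconnected `K` with a point at distance `> r`
from `p`, the component of any `x ∈ K ∩ B̄(p, r)` in `K ∩ B̄(p, r)` reaches the sphere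
`{dist · p = r}`. Kuratowski II §47.III. [cite: PommerenkeBBCM1992, §2.2] -/
theorem exists_mem_connectedComponentIn_sphere {K : Set X} (hK : IsCompact K) (hKc : IsPreconnected K)
    {p x : X} {r : ℝ} (hx : x ∈ K) (hxr : dist x p ≤ r) (hfar : ∃ y ∈ K, r < dist y p) :
    ∃ z ∈ connectedComponentIn (K ∩ closedBall p r) x, dist z p = r := by
  have hφ : Continuous fun z : X ↦ -dist z p := (continuous_id.dist continuous_const).neg
  obtain ⟨y, hyK, hyr⟩ := hfar
  obtain ⟨z, hz, hzr⟩ := exists_mem_connectedComponentIn_level hK hKc hφ (ρ := -r) hx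
    (neg_le_neg hxr) ⟨y, hyK, neg_lt_neg hyr⟩
  refine ⟨z, ?_, by linarith⟩
  have hset : K ∩ {z : X | -r ≤ -dist z p} = K ∩ closedBall p r := by
    ext w; simp [mem_closedBall, neg_le_neg_iff]
  rwa [hset] at hz

/-! ### The upper limit of a sequence of sets -/

/-- The **topological upper limit** `Ls Dₙ` of a sequence of sets: the points every ball about
which meets `Dₙ` for infinitely many `n`. Kuratowski II §47.II. [cite: PommerenkeBBCM1992, §2.2] -/
def seqLimsup (D : ℕ → Set X) : Set X :=
  {x | ∀ r > 0, ∃ᶠ n in atTop, (D n ∩ ball x r).Nonempty}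

section SeqLimsup

variable {D : ℕ → Set X}

/-- Limits of points `yₙ ∈ Dₙ` belong to `Ls Dₙ`. [folklore] -/
theorem mem_seqLimsup_of_tendsto {y : ℕ → X} {x : X} (hy : ∀ n, y n ∈ D n)
    (h : Tendsto y atTop (𝓝 x)) : x ∈ seqLimsup D := by
  intro r hr
  have hev : ∀ᶠ n in atTop, dist (y n) x < r := (Metric.tendsto_nhds.1 h) r hr
  exact (hev.mono fun n hn ↦ ⟨y n, hy n, mem_ball.2 hn⟩).frequently

/-- Limits of points `yₖ ∈ D_{φ k}` along a subsequence belong to `Ls Dₙ`. [folklore] -/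
theorem mem_seqLimsup_of_subseq {φ : ℕ → ℕ} (hφ : StrictMono φ) {y : ℕ → X} {x : X}
    (hy : ∀ k, y k ∈ D (φ k)) (h : Tendsto y atTop (𝓝 x)) : x ∈ seqLimsup D := by
  intro r hr
  have hev : ∀ᶠ k in atTop, dist (y k) x < r := (Metric.tendsto_nhds.1 h) r hr
  rw [frequently_atTop]
  intro N
  obtain ⟨k, hk⟩ := (hev.and (eventually_ge_atTop N)).exists
  exact ⟨φ k, hk.2.trans (hφ.id_le k), y k, hy k, mem_ball.2 hk.1⟩

/-- `Ls Dₙ` is closed. [folklore] -/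
theorem isClosed_seqLimsup : IsClosed (seqLimsup D) := by
  refine isClosed_iff_clusterPt.2 fun x hx ↦ ?_
  have hxcl : x ∈ closure (seqLimsup D) := mem_closure_iff_clusterPt.2 hx
  intro r hr
  obtain ⟨x', hx', hd⟩ := Metric.mem_closure_iff.1 hxcl (r / 2) (by linarith)
  refine (hx' (r / 2) (by linarith)).mono fun n ⟨w, hwD, hw⟩ ↦ ⟨w, hwD, ?_⟩
  rw [mem_ball] at hw ⊢
  calc dist w x ≤ dist w x' + dist x' x := dist_triangle _ _ _
    _ < r / 2 + r / 2 := add_lt_add hw (by rwa [dist_comm] at hd)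
    _ = r := by ring

/-- `Ls Dₙ` lies in any closed set containing all the `Dₙ`. [folklore] -/
theorem seqLimsup_subset {F : Set X} (hF : IsClosed F) (h : ∀ n, D n ⊆ F) : seqLimsup D ⊆ F := by
  intro x hx
  rw [← hF.closure_eq, Metric.mem_closure_iff]
  intro r hr
  obtain ⟨n, w, hwD, hw⟩ := (hx r hr).exists
  exact ⟨w, h n hwD, by rw [dist_comm]; exact mem_ball.1 hw⟩

/-- **The upper limit of connected sets is connected when the lower limit is non-empty**
(Kuratowski II §47.II Thm. 6): if the `Dₙ` are preconnected subsets of a compact set `F` and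
some `yₙ ∈ Dₙ` converge, then `Ls Dₙ` is preconnected. [cite: PommerenkeBBCM1992, §2.2] -/
theorem isPreconnected_seqLimsup (hD : ∀ n, IsPreconnected (D n)) {F : Set X} (hF : IsCompact F)
    (hDF : ∀ n, D n ⊆ F) {y : ℕ → X} {p : X} (hy : ∀ n, y n ∈ D n)
    (hyp : Tendsto y atTop (𝓝 p)) : IsPreconnected (seqLimsup D) := by
  set L := seqLimsup D with hL
  have hpL : p ∈ L := mem_seqLimsup_of_tendsto hy hyp
  have hLF : L ⊆ F := seqLimsup_subset hF.isClosed hDF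
  have hLc : IsCompact L := hF.of_isClosed_subset isClosed_seqLimsup hLF
  -- the key claim: `L` is not the union of two disjoint compact pieces, `p` in the first and
  -- the second non-empty
  have key : ∀ A B : Set X, IsCompact A → IsCompact B → Disjoint A B → p ∈ A → B.Nonempty →
      B ⊆ L → L ⊆ A ∪ B → False := by
    intro A B hA hB hAB hpA ⟨c, hcB⟩ hBL hLAB
    set g : X → ℝ := fun z ↦ infDist z A with hg
    have hgc : Continuous g := continuous_infDist_pt A
    obtain ⟨z₀, hz₀B, hz₀⟩ := hB.exists_isMinOn ⟨c, hcB⟩ hgc.continuousOn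
    set m : ℝ := g z₀ with hm
    have hAne : A.Nonempty := ⟨p, hpA⟩
    have hmpos : 0 < m :=
      (hA.isClosed.notMem_iff_infDist_pos hAne).1 (Set.disjoint_right.1 hAB hz₀B)
    have hmB : ∀ z ∈ B, m ≤ g z := fun z hz ↦ hz₀ hz
    -- infinitely often `Dₙ` joins the `m/3`-neighbourhood of `p ∈ A` to that of `c ∈ B`, so
    -- (intermediate values of `g = dist(·, A)`) contains a point `w` with `g w = m / 2`
    have hfreq : ∃ᶠ n in atTop, ∃ w ∈ D n, g w = m / 2 := by
      have h1 : ∃ᶠ n in atTop, (D n ∩ ball c (m / 3)).Nonempty := hBL hcB (m / 3) (by linarith)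
      have h2 : ∀ᶠ n in atTop, dist (y n) p < m / 3 := (Metric.tendsto_nhds.1 hyp) _ (by linarith)
      refine (h1.and_eventually h2).mono fun n ⟨⟨x', hx'D, hx'c⟩, hyn⟩ ↦ ?_
      have hgy : g (y n) ≤ m / 3 :=
        ((infDist_le_dist_of_mem hpA).trans hyn.le)
      have hgx' : 2 * m / 3 ≤ g x' := by
        have h3 : g c ≤ g x' + dist c x' := infDist_le_infDist_add_dist
        have h4 : dist c x' < m / 3 := by rw [dist_comm]; exact mem_ball.1 hx'c
        have h5 : m ≤ g c := hmB c hcB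
        linarith
      have hIVT := (hD n).intermediate_value (hy n) hx'D hgc.continuousOn
      obtain ⟨w, hwD, hgw⟩ := hIVT (show m / 2 ∈ Icc (g (y n)) (g x') from ⟨by linarith, by linarith⟩)
      exact ⟨w, hwD, hgw⟩
    obtain ⟨φ, hφ, hφP⟩ := extraction_of_frequently_atTop hfreq
    choose w hwD hgw using hφP
    obtain ⟨w₀, -, ψ, hψ, hconv⟩ := hF.tendsto_subseq (x := w) fun k ↦ hDF _ (hwD k)
    have hw₀L : w₀ ∈ L :=
      mem_seqLimsup_of_subseq (hφ.comp hψ) (y := w ∘ ψ) (fun k ↦ hwD (ψ k)) hconv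
    have hgw₀ : g w₀ = m / 2 := by
      have h1 : Tendsto (fun k ↦ g ((w ∘ ψ) k)) atTop (𝓝 (g w₀)) := (hgc.tendsto w₀).comp hconv
      have h2 : (fun k ↦ g ((w ∘ ψ) k)) = fun _ ↦ m / 2 := by
        funext k; exact hgw (ψ k)
      rw [h2] at h1
      exact tendsto_nhds_unique h1 tendsto_const_nhds ▸ rfl
    rcases hLAB hw₀L with hw₀A | hw₀B
    · have : g w₀ = 0 := infDist_zero_of_mem hw₀A
      linarith
    · have := hmB w₀ hw₀B
      linarith
  rw [isPreconnected_closed_iff]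
  intro t t' ht ht' hLtt' ⟨a, haL, hat⟩ ⟨b, hbL, hbt'⟩
  by_contra hempty
  have hempty' : L ∩ (t ∩ t') = ∅ := not_nonempty_iff_eq_empty.1 hempty
  have hdisj : Disjoint (L ∩ t) (L ∩ t') := by
    rw [Set.disjoint_iff]
    rintro z ⟨⟨hzL, hzt⟩, -, hzt'⟩
    have : z ∈ L ∩ (t ∩ t') := ⟨hzL, hzt, hzt'⟩
    rw [hempty'] at this
    exact this
  have hcover : L ⊆ L ∩ t ∪ L ∩ t' := fun z hz ↦
    (hLtt' hz).elim (fun h ↦ Or.inl ⟨hz, h⟩) (fun h ↦ Or.inr ⟨hz, h⟩)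
  rcases hLtt' hpL with hpt | hpt'
  · exact key (L ∩ t) (L ∩ t') (hLc.inter_right ht) (hLc.inter_right ht') hdisj ⟨hpL, hpt⟩
      ⟨b, hbL, hbt'⟩ inter_subset_left hcover
  · exact key (L ∩ t') (L ∩ t) (hLc.inter_right ht') (hLc.inter_right ht) hdisj.symm ⟨hpL, hpt'⟩
      ⟨a, haL, hat⟩ inter_subset_left (fun z hz ↦ (hcover hz).symm)

end SeqLimsup

/-! ### Moore's theorem: no isolated point of non-connectedness im kleinen -/

/-- **Moore's theorem** (Kuratowski II §49.VI; Whyburn (1942), I (12.3)): a compact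
preconnected set which is connected im kleinen at each of its points other than `p` is connected
im kleinen at `p` too. [cite: PommerenkeBBCM1992, §2.2] -/
theorem IsCIKAt.of_forall_ne {K : Set X} (hK : IsCompact K) (hKc : IsPreconnected K) {p : X}
    (hp : p ∈ K) (h : ∀ x ∈ K, x ≠ p → IsCIKAt K x) : IsCIKAt K p := by
  by_contra hnot
  simp only [IsCIKAt, not_forall, not_exists, exists_prop, not_and] at hnot
  obtain ⟨ε, hε, hbadε⟩ := hnot
  -- `K` is not inside `B(p, ε)` (else the component of `p` there is all of `K`)
  have hfar : ∃ y₀ ∈ K, ε ≤ dist y₀ p := by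
    by_contra hfar
    push Not at hfar
    have hKball : K ∩ ball p ε = K := inter_eq_left.2 fun y hy ↦ mem_ball.2 (hfar y hy)
    refine hbadε 1 one_pos ?_
    rw [hKball]
    exact inter_subset_left.trans (hKc.subset_connectedComponentIn hp Subset.rfl)
  set e : ℝ := ε / 2 with he
  have hepos : 0 < e := by positivity
  have heε : e < ε := by rw [he]; linarith
  -- bad points `yₙ → p` outside the component `C` of `p` in `K ∩ B(p, ε)`
  set C : Set X := connectedComponentIn (K ∩ ball p ε) p with hC
  have hbad : ∀ n : ℕ, ∃ y ∈ K, dist y p < min (1 / ((n : ℝ) + 1)) e ∧ y ∉ C := by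
    intro n
    have hδ : 0 < min (1 / ((n : ℝ) + 1)) e := lt_min (by positivity) hepos
    have := hbadε _ hδ
    rw [not_subset] at this
    obtain ⟨y, ⟨hyK, hyb⟩, hyC⟩ := this
    exact ⟨y, hyK, mem_ball.1 hyb, hyC⟩
  choose y hyK hyd hyC using hbad
  have hyp : Tendsto y atTop (𝓝 p) := by
    rw [Metric.tendsto_nhds]
    intro r hr
    obtain ⟨N, hN⟩ := exists_nat_gt (1 / r)
    refine eventually_atTop.2 ⟨N, fun n hn ↦ ?_⟩
    have h1 : dist (y n) p < 1 / ((n : ℝ) + 1) := (hyd n).trans_le (min_le_left _ _)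
    have h2 : 1 / ((n : ℝ) + 1) ≤ r := by
      rw [div_le_iff₀ (by positivity)]
      have hN' : (N : ℝ) ≤ n := by exact_mod_cast hn
      have : 1 / r < (n : ℝ) + 1 := by linarith
      rw [div_lt_iff₀ hr] at this
      linarith
    exact h1.trans_le h2
  -- their components `Dₙ` in `F = K ∩ B̄(p, e)`
  set F : Set X := K ∩ closedBall p e with hF
  have hFc : IsCompact F := hK.inter_right isClosed_closedBall
  set D : ℕ → Set X := fun n ↦ connectedComponentIn F (y n) with hD
  have hyF : ∀ n, y n ∈ F := fun n ↦ ⟨hyK n, mem_closedBall.2 ((hyd n).le.trans (min_le_right _ _))⟩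
  have hyDn : ∀ n, y n ∈ D n := fun n ↦ mem_connectedComponentIn (hyF n)
  have hDF : ∀ n, D n ⊆ F := fun n ↦ connectedComponentIn_subset _ _
  -- `Dₙ` reaches the sphere of radius `e` (boundary bumping)
  have hz : ∀ n, ∃ z ∈ D n, dist z p = e := fun n ↦ by
    obtain ⟨y₀, hy₀K, hy₀⟩ := hfar
    exact exists_mem_connectedComponentIn_sphere hK hKc (hyK n)
      ((hyd n).le.trans (min_le_right _ _)) ⟨y₀, hy₀K, heε.trans_le hy₀⟩
  choose z hzD hzd using hz
  -- the continuum `L = Ls Dₙ` through `p`, inside the component `C'` of `p` in `F`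
  set L := seqLimsup D with hL
  have hpL : p ∈ L := mem_seqLimsup_of_tendsto hyDn hyp
  have hLF : L ⊆ F := seqLimsup_subset hFc.isClosed hDF
  have hLconn : IsPreconnected L :=
    isPreconnected_seqLimsup (fun n ↦ isPreconnected_connectedComponentIn) hFc hDF hyDn hyp
  set C' : Set X := connectedComponentIn F p with hC'
  have hLC' : L ⊆ C' := hLconn.subset_connectedComponentIn hpL hLF
  have hC'C : C' ⊆ C := connectedComponentIn_mono p
    (inter_subset_inter_right _ (closedBall_subset_ball heε))
  -- a point of `L` on the sphere of radius `e`, hence one at distance `e / 2`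
  obtain ⟨z₀, -, ψ, hψ, hconv⟩ := hFc.tendsto_subseq (x := z) fun n ↦ hDF n (hzD n)
  have hz₀L : z₀ ∈ L := mem_seqLimsup_of_subseq hψ (y := z ∘ ψ) (fun k ↦ hzD (ψ k)) hconv
  have hz₀d : dist z₀ p = e := by
    have h1 : Tendsto (fun k ↦ dist ((z ∘ ψ) k) p) atTop (𝓝 (dist z₀ p)) :=
      (continuous_id.dist continuous_const).continuousAt.tendsto.comp hconv
    have h2 : (fun k ↦ dist ((z ∘ ψ) k) p) = fun _ ↦ e := by funext k; exact hzd (ψ k)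
    rw [h2] at h1
    exact tendsto_nhds_unique h1 tendsto_const_nhds
  obtain ⟨q, hqL, hqd⟩ : ∃ q ∈ L, dist q p = e / 2 := by
    have hcd : Continuous fun w : X ↦ dist w p := continuous_id.dist continuous_const
    have hIVT := hLconn.intermediate_value hpL hz₀L (f := fun w ↦ dist w p) hcd.continuousOn
    have hmem : e / 2 ∈ Icc (dist p p) (dist z₀ p) := by
      rw [dist_self, hz₀d]; exact ⟨by linarith, by linarith⟩
    obtain ⟨q, hqL, hq⟩ := hIVT hmem
    exact ⟨q, hqL, hq⟩
  have hqK : q ∈ K := (hLF hqL).1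
  have hqp : q ≠ p := by
    intro hqp; rw [hqp, dist_self] at hqd; linarith
  -- connectedness im kleinen at `q`, radius `e / 4`
  obtain ⟨δq, hδq, hVsub⟩ := h q hqK hqp (e / 4) (by positivity)
  set V : Set X := connectedComponentIn (K ∩ ball q (e / 4)) q with hV
  have hqV : q ∈ V := mem_connectedComponentIn ⟨hqK, mem_ball_self (by positivity)⟩
  have hVF : V ⊆ F := by
    intro v hv
    obtain ⟨hvK, hvq⟩ := connectedComponentIn_subset _ _ hv
    refine ⟨hvK, mem_closedBall.2 ?_⟩
    calc dist v p ≤ dist v q + dist q p := dist_triangle _ _ _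
      _ ≤ e / 4 + e / 2 := add_le_add (mem_ball.1 hvq).le hqd.le
      _ ≤ e := by linarith
  -- some `Dₙ` meets `B(q, δq)`, hence contains `V ∋ q`, hence is the component of `p`
  obtain ⟨n, x', hx'D, hx'q⟩ := (hqL δq hδq).exists
  have hx'V : x' ∈ V := hVsub ⟨(hDF n hx'D).1, hx'q⟩
  have hVD : V ⊆ D n := by
    have h1 : V ⊆ connectedComponentIn F x' :=
      isPreconnected_connectedComponentIn.subset_connectedComponentIn hx'V hVF
    rwa [← connectedComponentIn_eq hx'D] at h1
  have hqD : q ∈ D n := hVD hqV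
  have hDC' : D n = C' := by
    show connectedComponentIn F (y n) = C'
    rw [connectedComponentIn_eq hqD, ← connectedComponentIn_eq (hLC' hqL)]
  exact hyC n (hC'C (hDC' ▸ hyDn n))

/-! ### From connectedness im kleinen everywhere to uniform local connectedness -/

/-- **A compact set connected im kleinen at each of its points is uniformly locally connected**
(Pommerenke's hypothesis, `IsUniformlyLocallyConnected`): by a finite subcover, nearby points
lie in the closure of one small component. Whyburn (1942), I §12. [cite: PommerenkeBBCM1992, §2.2] -/
theorem isUniformlyLocallyConnected_of_forall_isCIKAt {K : Set X} (hK : IsCompact K)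
    (h : ∀ x ∈ K, IsCIKAt K x) : IsUniformlyLocallyConnected K := by
  intro η hη
  -- radii `δ x ≤ η / 2` of connectedness im kleinen at `x` for the target radius `η / 2`
  have hδ : ∀ x, ∃ δ > 0, δ ≤ η / 2 ∧ (x ∈ K →
      K ∩ ball x δ ⊆ connectedComponentIn (K ∩ ball x (η / 2)) x) := by
    intro x
    by_cases hx : x ∈ K
    · obtain ⟨δ, hδ, hsub⟩ := h x hx (η / 2) (by linarith)
      exact ⟨min δ (η / 2), lt_min hδ (by linarith), min_le_right _ _, fun _ ↦
        (inter_subset_inter_right _ (ball_subset_ball (min_le_left _ _))).trans hsub⟩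
    · exact ⟨η / 2, by linarith, le_rfl, fun hx' ↦ absurd hx' hx⟩
  choose δ hδpos hδle hδsub using hδ
  obtain ⟨t, htK, hcover⟩ := hK.elim_nhds_subcover (fun x ↦ ball x (δ x / 2))
    (fun x _ ↦ ball_mem_nhds x (by linarith [hδpos x]))
  -- a positive lower bound for the finitely many radii
  obtain ⟨d, hd, hdle⟩ : ∃ d > 0, ∀ x ∈ t, d ≤ δ x / 2 := by
    rcases t.eq_empty_or_nonempty with ht | ht
    · exact ⟨1, one_pos, fun x hx ↦ by simp [ht] at hx⟩
    · refine ⟨t.inf' ht fun x ↦ δ x / 2, ?_, fun x hx ↦ Finset.inf'_le _ hx⟩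
      refine (Finset.lt_inf'_iff ht).2 fun x _ ↦ ?_
      linarith [hδpos x]
  refine ⟨d, hd, fun a ha b hb hab ↦ ?_⟩
  obtain ⟨x, hxt, hax⟩ : ∃ x ∈ t, a ∈ ball x (δ x / 2) := by
    simpa only [mem_iUnion, exists_prop] using hcover ha
  have hxK : x ∈ K := htK x hxt
  have haδ : a ∈ K ∩ ball x (δ x) := ⟨ha, ball_subset_ball (by linarith [hδpos x]) hax⟩
  have hbδ : b ∈ K ∩ ball x (δ x) := by
    refine ⟨hb, mem_ball.2 ?_⟩
    calc dist b x ≤ dist b a + dist a x := dist_triangle _ _ _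
      _ < d + δ x / 2 := add_lt_add (by rwa [dist_comm] at hab) (mem_ball.1 hax)
      _ ≤ δ x := by linarith [hdle x hxt]
  set V : Set X := connectedComponentIn (K ∩ ball x (η / 2)) x with hV
  have haV : a ∈ V := hδsub x hxK haδ
  have hbV : b ∈ V := hδsub x hxK hbδ
  have hVsub : V ⊆ K ∩ ball x (η / 2) := connectedComponentIn_subset _ _
  refine ⟨closure V, ?_, ?_, isPreconnected_connectedComponentIn.closure, subset_closure haV,
    subset_closure hbV, ?_⟩
  · exact (closure_mono (hVsub.trans inter_subset_left)).trans hK.isClosed.closure_subset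
  · refine (hK.inter_right isClosed_closedBall : IsCompact (K ∩ closedBall x (η / 2))).of_isClosed_subset
      isClosed_closure ?_
    exact closure_minimal (hVsub.trans (inter_subset_inter_right _ ball_subset_closedBall))
      ((hK.inter_right isClosed_closedBall).isClosed)
  · refine closure_minimal (fun v hv ↦ mem_closedBall.2 ?_) isClosed_closedBall
    have hvx : dist v x < η / 2 := mem_ball.1 (hVsub hv).2
    have hax' : dist a x < η / 4 := by
      have := mem_ball.1 hax
      linarith [hδle x]
    calc dist v a ≤ dist v x + dist x a := dist_triangle _ _ _
      _ ≤ η / 2 + η / 4 := add_le_add hvx.le (by rw [dist_comm]; exact hax'.le)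
      _ ≤ η := by linarith

/-- **A continuum connected im kleinen off one point is uniformly locally connected**
(`IsCIKAt.of_forall_ne` and `isUniformlyLocallyConnected_of_forall_isCIKAt`).
[cite: PommerenkeBBCM1992, §2.2] -/
theorem isUniformlyLocallyConnected_of_forall_ne {K : Set X} (hK : IsCompact K)
    (hKc : IsPreconnected K) {p : X} (h : ∀ x ∈ K, x ≠ p → IsCIKAt K x) :
    IsUniformlyLocallyConnected K := by
  refine isUniformlyLocallyConnected_of_forall_isCIKAt hK fun x hx ↦ ?_
  by_cases hxp : x = p
  · subst hxp; exact IsCIKAt.of_forall_ne hK hKc hx h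
  · exact h x hx hxp

end Literature.Topology.PlaneTopology
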